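import Literature.Computability.Complexity.OracleSimulateFP
import HarnessLib

/-!
# The first query of an oracle algorithm, and re-presenting outputs on their range

Topic `Literature/Computability/Complexity`; two small companions of `OracleComposition.lean`
(`OracleAlg.mapOut`) and `OracleSimulateFP.lean` (`OracleAlg.simFn`: an emulated run is an `FP`
string function), needed by reductions that (a) must name, as a deterministic polynomial-time
function of the coins, the query an emulated adversary is ABOUT to ask — the "initial adversary
`A₀`" of a designated-collision (UOWHF) attack built from a forger (Goldreich 2004, proof of
Prop. 6.4.31, Stage 1: "Once `α⁽ⁱ⁾` is issued, algorithm `B'` completes its first stage") — and (b)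
re-present the outputs of a transformed algorithm whose outputs are known to lie in a sub-range:

* `OracleAlg.firstQuery M` — the query-free algorithm that outputs `M`'s first query on `x` (and `ε`
  if `M` outputs without asking); `firstQuery_step`, `run_firstQuery`,
  `OracleAlg.isPolyTime_firstQuery` (the step code `0q ↦ 1q`, `1b ↦ 1` is a transducer away);
  `OracleAlg.firstQueryFn M pre w` — the first query of `M` on `pre w` as an `FP` string function
  (`firstQueryFn_mem_FP`, `firstQueryFn_eq`);
* `OracleAlg.IsPolyTime.mapOut_of_range` — `M.mapOut φ` is polynomial-time when `φ` preserves the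
  codes of the outputs `M` actually produces (the hypothesis of `IsPolyTime.mapOut` restricted to the
  range of the step function).

## References

* S. Arora, B. Barak, *Computational Complexity: A Modern Approach*, CUP 2009, §3.4.
* O. Goldreich, *Foundations of Cryptography II: Basic Applications*, CUP 2004, §6.4.3.3 (proof of
  Prop. 6.4.31, the three stages of `B'`), as the consumer shape.
-/

namespace Literature.Computability.Complexity

open _root_.Computability Polynomial Brick

namespace OracleAlg

variable {β : Type}

/-! ### Re-presenting outputs on their range -/

/-- **`M.mapOut φ` is polynomial-time** when `φ` does not change the codes of the outputs that `M`
actually produces (same machine). [folklore] -/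
theorem IsPolyTime.mapOut_of_range {γ : Type} {M : OracleAlg β} {eb : Encoding β Bool}
    {ec : Encoding γ Bool} (h : M.IsPolyTime eb) (φ : β → γ)
    (hφ : ∀ x as b, M.step x as = Sum.inr b → ec.encode (φ b) = eb.encode b) : (M.mapOut φ).IsPolyTime ec := by
  obtain ⟨p, T, hT⟩ := h
  refine ⟨p, T, fun a => ?_⟩
  have h1 := hT a
  have h2 : ((encodingList Bool).sumBool ec).encode (Function.uncurry (M.mapOut φ).step a) =
      ((encodingList Bool).sumBool eb).encode (Function.uncurry M.step a) := by
    obtain ⟨x, ans⟩ := a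
    simp only [Function.uncurry, OracleAlg.mapOut]
    cases hs : M.step x ans with
    | inl q => rfl
    | inr b => simp [Encoding.sumBool, hφ x ans b hs]
  rw [h2]
  exact h1

/-! ### The first query -/

/-- **The first-query algorithm**: asks nothing; outputs `M`'s query if `M`'s step on the empty
transcript (indeed on any transcript) is a query, and `ε` if it is an output. [Goldreich 2004, proof of
Prop. 6.4.31 (Stage 1 of `B'`)] [cite: Goldreich2004, Prop. 6.4.31] -/
def firstQuery (M : OracleAlg β) : OracleAlg (List Bool) where
  step x as := match M.step x as with
    | Sum.inl q => Sum.inr q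
    | Sum.inr _ => Sum.inr []

/-- The step of `M.firstQuery` (definitional). [folklore] -/
theorem firstQuery_step (M : OracleAlg β) (x : List Bool) (as : List (List Bool)) :
    M.firstQuery.step x as = (match M.step x as with | Sum.inl q => Sum.inr q | Sum.inr _ => Sum.inr []) := rfl

/-- `M.firstQuery` outputs within one round, against any oracle. [folklore] -/
theorem run_firstQuery (M : OracleAlg β) (O' : Oracle) (x : List Bool) (k : ℕ) :
    M.firstQuery.run O' (k + 1) x = some (match M.step x [] with | Sum.inl q => q | Sum.inr _ => []) := by
  rw [run, runAux_succ, firstQuery_step]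
  cases M.step x [] <;> rfl

/-- The head of a nonempty query transcript is the query of the first step. [folklore] -/
theorem step_eq_inl_of_queries_eq_cons (M : OracleAlg β) (O : Oracle) (x : List Bool) (n : ℕ) {q : List Bool}
    {qs : List (List Bool)} (hq : M.queries O n x = q :: qs) : M.step x [] = Sum.inl q := by
  cases n with
  | zero => simp [queries, queriesAux] at hq
  | succ n =>
    simp only [queries, queriesAux] at hq
    cases hs : M.step x [] with
    | inl q' => rw [hs] at hq; simp only [List.cons.injEq] at hq; rw [hq.1]
    | inr b => rw [hs] at hq; simp at hq

/-- States of the tag transducer: before / after the tag bit. [folklore] -/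
inductive FQ
  | start
  | copy
  | drain
  deriving DecidableEq, Fintype

/-- Transition: `0 q ↦ 1 q` (copy after a `0` tag), `1 b ↦ 1` (drain after a `1` tag). [folklore] -/
def fqStep : FQ → Bool → FQ × List Bool
  | .start, false => (.copy, [true])
  | .start, true => (.drain, [true])
  | .copy, c => (.copy, [c])
  | .drain, _ => (.drain, [])

/-- The tag transducer of `firstQuery`. [folklore] -/
def fqT : FST FQ Bool Bool where
  init := .start
  step := fqStep
  front := fun _ => []
  keep := fun _ => true

/-- The transition of `fqT` (definitional). [folklore] -/
@[simp] theorem fqT_step (s : FQ) (b : Bool) : fqT.step s b = fqStep s b := rfl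

/-- The copier of `fqT`. [folklore] -/
theorem fqT_run_copy (l : List Bool) : (fqT.run .copy l).2 = l := by
  induction l with
  | nil => rfl
  | cons b l ih => simp [FST.run_cons, fqStep, ih]

/-- The drain of `fqT`. [folklore] -/
theorem fqT_run_drain (l : List Bool) : (fqT.run .drain l).2 = [] := by
  induction l with
  | nil => rfl
  | cons b l ih => simp [FST.run_cons, fqStep, ih]

/-- `fqT (0 q) = 1 q`. [folklore] -/
theorem fqT_eval_false (q : List Bool) : fqT.eval (false :: q) = true :: q := by
  have he : ∀ w, fqT.eval w = (fqT.run .start w).2 := fun w => by simp [FST.eval, fqT]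
  rw [he]; simp [FST.run_cons, fqStep, fqT_run_copy]

/-- `fqT (1 b) = 1`. [folklore] -/
theorem fqT_eval_true (b : List Bool) : fqT.eval (true :: b) = [true] := by
  have he : ∀ w, fqT.eval w = (fqT.run .start w).2 := fun w => by simp [FST.eval, fqT]
  rw [he]; simp [FST.run_cons, fqStep, fqT_run_drain]

/-- **`M.firstQuery` is polynomial-time** when `M` is: its step code is `M`'s step code through the
transducer `fqT`. [Arora–Barak 2009, §3.4 with §1.3] [cite: AroraBarak2009, §3.4] -/
theorem isPolyTime_firstQuery {M : OracleAlg β} {eb : Encoding β Bool} (hM : M.IsPolyTime eb) :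
    M.firstQuery.IsPolyTime (encodingList Bool) := by
  unfold IsPolyTime at hM ⊢
  have h := PolyTimeComputable.comp_holds fqT.polyTimeComputable_eval hM
  refine PolyTimeComputable.of_encode h id (fun _ => rfl) fun a => ?_
  obtain ⟨x, as⟩ := a
  simp only [Function.comp_apply, Function.uncurry_apply_pair, id, firstQuery_step]
  cases M.step x as with
  | inl q => exact fqT_eval_false q
  | inr b => exact fqT_eval_true _

/-- **The first query as an `FP` string function**: `firstQueryFn M pre w` = the first query of `M`
run on `pre w` (any oracle: the first query does not depend on it), `ε` if none. [Goldreich 2004,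
proof of Prop. 6.4.31 (Stage 1: the designated pre-image `x₀ = A₀(r)`)] [cite: Goldreich2004, Prop. 6.4.31] -/
noncomputable def firstQueryFn (M : OracleAlg β) (pre : List Bool → List Bool) : List Bool → List Bool :=
  simFn M.firstQuery pre (fun _ => []) 0 1

/-- `firstQueryFn ∈ FP` for `M` polynomial-time and `pre ∈ FP`. [cite: AroraBarak2009, §3.4 Example 3.6 (2)] -/
theorem firstQueryFn_mem_FP {M : OracleAlg β} {eb : Encoding β Bool} (hM : M.IsPolyTime eb)
    {pre : List Bool → List Bool} (hpre : pre ∈ FP) : firstQueryFn M pre ∈ FP :=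
  simFn_mem_FP (isPolyTime_firstQuery hM) hpre (const_mem_FP []) 0 1

/-- **Semantics**: `firstQueryFn M pre w` is the first query `M` asks on `pre w` (against ANY oracle `O`),
whenever it asks one. [cite: AroraBarak2009, §3.4] -/
theorem firstQueryFn_eq {M : OracleAlg β} {pre : List Bool → List Bool} {w : List Bool} (O : Oracle) {n : ℕ}
    {q : List Bool} {qs : List (List Bool)} (hq : M.queries O n (pre w) = q :: qs) : firstQueryFn M pre w = q := by
  have hstep := step_eq_inl_of_queries_eq_cons M O (pre w) n hq
  refine simFn_eq_of_run (c := 0) (R := 1) ?_ ?_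
  · rw [eval_one, show (1 : ℕ) = 0 + 1 from rfl, run_firstQuery, hstep]
  · intro q' hq'
    rw [eval_one, queries, show (1 : ℕ) = 0 + 1 from rfl, queriesAux, firstQuery_step, hstep] at hq'
    simp at hq'

end OracleAlg

end Literature.Computability.Complexity
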